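import Summits.Parity.GeneralizedHardyLittlewood.Theorems.PrimeLevelFamEdgeIdeaDeltasZetaPrimeWindowDefs
import Mathlib.Analysis.Convex.Slope
import HarnessLib

/-!
# Route `PrimeLevelFamEdge` — TYPED IDEA DELTAS, deck 24: `barrier` lens × CI-GAPS — K-L21-5 «THE PROFILE LAW AND THE CEILING
# NO-GO FOR THE ζ′-DOOR» (cell ls-idea, seat ls-idea-lens-21 gen 4, card K-L21-5; the seat's `Sketch_L21_ProfileLaw.lean` sha16
# 637e651f8d06186b, critic F b28 PASS (FIX 1 = wording, precisions P-F28-1…4); LANDING NOTE typer ls-idea-typ-1 gen 3: VERBATIM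
# (already in the deck namespace `…IdeaDeltas.ZetaPrimeProfile`, imports deck 23) up to this header, two added docstrings and
# P-F28-1 recorded in the docstring of `logProfile`.)

Statement shapes + bookkeeping only; nothing here is a theorem about `ζ`.  Units as in deck 23
(`…IdeaDeltas.ZetaPrimeWindow`): abscissa `ν = (β′ − ½)·log T`; `Radziwill2014.derivRatio ν T` is the tree's
normalised count `(2π/(T log T))·#{ρ′ : ζ′ ρ′ = 0, T ≤ γ′ ≤ 2T, (β′ − ½) log T ≤ ν}` (`m′(ν)` with the liminf unfolded).

* `logProfile ν T` — the finite-`T` vertical log-average `𝒢_T(ν) = (1/T)∫_T^{2T} log(‖ζ′(½ + ν/log T + it)‖ / log T) dt`.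
* `LogProfileFloor ν_f δ` — eventually `𝒢_T(ν_f) ≥ −ν_f + δ` (a FLOOR right of the line: the statement class just
  OUTSIDE the ceiling class W-ζ′-CEIL of the card).
* `LogProfileCeiling ν U` — eventually `𝒢_T(ν) ≤ U` (what a mollified / unmollified mean square + Jensen gives).
* `ProfileSupplyLaw ν_f ν₀` — NAMED pencil fact (RH; Littlewood's lemma in differential form + convexity + the left
  anchor `𝒢(ν) = |ν|` for `ν ≤ 0`): for `0 < ν_f ≤ ν₀`, `m′(ν₀) ≥ (𝒢(ν_f) + ν_f)/ν_f − o(1)`.  NOT proved here.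
* `supply_of_floor` — PROVED (arithmetic over the named law): a floor at `ν_f ≤ ν₀` with margin `δ` supplies the
  door's producer `ZetaPrimeWindow.FixedScaleDerivSupply ν₀ η` for every `η < δ/ν_f`.
* `clockProfile` + `ceilingOnly_noGo` — PROVED (real analysis, the witness of the card's NO-GO): the linear profile
  `ν ↦ −ν` is convex, has the correct left values `|ν|` (`ν ≤ 0`), satisfies EVERY admissible ceiling (`U ν ≥ −ν`,
  which any true ceiling must), and certifies supply `0` at every `ν₀ > 0`; hence no inference from
  {ceilings, left anchor, convexity} alone yields `m′(ν₀) ≥ η > 0`.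
* `floor_propagates_right` — PROVED (Mathlib convexity): a floor at `ν_f ≤ ν₀` bounds every secant slope right of `ν₀`
  from below by `g ν_f / ν_f`; floors act only to their RIGHT.
HONESTY: no exceptional-zero theorem (no Landau–Siegel / Siegel-zero exclusion, no Theorem 1–2 of arXiv:2211.02515, no
repaired Margin232) is proved; `ProfileSupplyLaw` is a hypothesis; typed ≠ proved; computed ≠ proved.
-/

noncomputable section

namespace Summit.Parity.GeneralizedHardyLittlewood.Theorems.PrimeLevelFamEdgeIdeaDeltas.ZetaPrimeProfile

open Literature.NumberTheory.LFunctions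
open Summit.Parity.GeneralizedHardyLittlewood.Theorems.PrimeLevelFamEdgeIdeaDeltas.ZetaPrimeWindow

/-- Finite-`T` vertical log-average of `ζ′` on the abscissa `½ + ν/log T`, normalised by `log T`:
`𝒢_T(ν) = (1/T) ∫_T^{2T} log ( ‖ζ′(½ + ν/log T + it)‖ / log T ) dt`.  (Critic F P-F28-1: Lean's `intervalIntegral` returns
the junk value `0` for a non-integrable integrand, so any PRODUCER of a `LogProfileFloor` / `LogProfileCeiling` statement must
also record `IntervalIntegrable` of this integrand on `[T, 2T]`; the shapes below do not assert it.) -/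
def logProfile (ν T : ℝ) : ℝ :=
  (1 / T) * ∫ t in T..(2 * T),
    Real.log (‖deriv riemannZeta ((1 / 2 : ℂ) + ((ν / Real.log T : ℝ) : ℂ) + (t : ℂ) * Complex.I)‖ / Real.log T)

/-- PROFILE FLOOR at abscissa `ν_f` with margin `δ`: eventually `𝒢_T(ν_f) ≥ −ν_f + δ`. -/
def LogProfileFloor (ν_f δ : ℝ) : Prop :=
  ∃ T₀ : ℝ, ∀ T : ℝ, T₀ ≤ T → -ν_f + δ ≤ logProfile ν_f T

/-- PROFILE CEILING at abscissa `ν` with bound `U`: eventually `𝒢_T(ν) ≤ U` (Jensen / mean-value type input). -/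
def LogProfileCeiling (ν U : ℝ) : Prop :=
  ∃ T₀ : ℝ, ∀ T : ℝ, T₀ ≤ T → logProfile ν T ≤ U

/-- NAMED PENCIL FACT (RH): the one-sided, integrated SUPPLY–PROFILE law.  For `0 < ν_f ≤ ν₀`:
`m′(ν₀) ≥ (𝒢(ν_f) + ν_f)/ν_f − o(1)`, i.e. `𝒢(ν_f) + ν_f = ∫₀^{ν_f} m′ ≤ ν_f · m′(ν_f) ≤ ν_f · m′(ν₀)`
(Littlewood's lemma in differential form `𝒢′ = m′ − 1` on `ν > 0`, the left anchor `𝒢(0) = 0`, monotonicity of `m′`).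
A hypothesis here, never asserted.
[cite: Titchmarsh1986, §9.9 (Littlewood's lemma) and §10.28 p. 211 (Levinson–Montgomery: `2π Σ (β′ − ½)` from `∫ log|ζ′|` on vertical lines)] -/
def ProfileSupplyLaw (ν_f ν₀ : ℝ) : Prop :=
  RiemannHypothesis → 0 < ν_f → ν_f ≤ ν₀ →
    ∀ ε : ℝ, 0 < ε → ∃ T₀ : ℝ, ∀ T : ℝ, T₀ ≤ T →
      (logProfile ν_f T + ν_f) / ν_f - ε ≤ Radziwill2014.derivRatio ν₀ T

/-- PROVED (arithmetic over the named law): a profile floor at `ν_f ≤ ν₀` with margin `δ` supplies the door's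
producer at scale `ν₀` with every proportion `η < δ/ν_f`. -/
theorem supply_of_floor {ν_f ν₀ δ η : ℝ} (hLaw : ProfileSupplyLaw ν_f ν₀) (hRH : RiemannHypothesis)
    (hνf : 0 < ν_f) (hle : ν_f ≤ ν₀) (hFloor : LogProfileFloor ν_f δ) (hη : η < δ / ν_f) :
    FixedScaleDerivSupply ν₀ η := by
  obtain ⟨T₁, hT₁⟩ := hFloor
  have hε : 0 < δ / ν_f - η := sub_pos.mpr hη
  obtain ⟨T₂, hT₂⟩ := hLaw hRH hνf hle (δ / ν_f - η) hε
  refine ⟨max T₁ T₂, fun T hT => ?_⟩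
  have h1 := hT₁ T ((le_max_left _ _).trans hT)
  have h2 := hT₂ T ((le_max_right _ _).trans hT)
  have h3 : δ / ν_f ≤ (logProfile ν_f T + ν_f) / ν_f := by
    rw [div_le_div_iff_of_pos_right hνf]; linarith
  linarith

/-- The CLOCK / worst-case profile `ν ↦ −ν` (the `T → ∞` log-profile of a picket-fence zero set: `|ζ′/ζ|/log ≈ e^{−ν}`,
no `ζ′`-zero at any fixed `ν`; critic F's E1′). -/
def clockProfile : ℝ → ℝ := fun ν => -ν

/-- The clock profile is convex (it is linear). -/
theorem clockProfile_convexOn : ConvexOn ℝ Set.univ clockProfile := by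
  refine ⟨convex_univ, ?_⟩
  intro x _ y _ a b _ _ _
  simp only [clockProfile, smul_eq_mul]
  exact le_of_eq (by ring)

/-- Left anchor: for `ν ≤ 0` the clock profile has the exact left values `|ν|` (as the true profile does under RH). -/
theorem clockProfile_left (ν : ℝ) (hν : ν ≤ 0) : clockProfile ν = |ν| := by
  simp [clockProfile, abs_of_nonpos hν]

/-- CEILING DATA: abscissae `pts` with upper bounds `U`.  ADMISSIBLE = consistent with the universal floor
`𝒢(ν) ≥ −ν`, which every TRUE ceiling is (under RH `𝒢_true(ν) = −ν + ∫₀^ν m′ ≥ −ν`); mollified or not, any length `θ`,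
any finite or infinite family of lines — the class only ever delivers numbers `U ν ≥ 𝒢_true(ν) ≥ −ν`. -/
structure CeilingData where
  pts : Set ℝ
  U : ℝ → ℝ
  admissible : ∀ ν ∈ pts, -ν ≤ U ν

/-- A candidate profile is CONSISTENT with everything the ceiling class knows: convex, exact left values, below
every ceiling. -/
def Consistent (D : CeilingData) (g : ℝ → ℝ) : Prop :=
  ConvexOn ℝ Set.univ g ∧ (∀ ν : ℝ, ν ≤ 0 → g ν = |ν|) ∧ ∀ ν ∈ D.pts, g ν ≤ D.U ν

/-- The clock profile is consistent with every admissible ceiling datum. -/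
theorem clock_consistent (D : CeilingData) : Consistent D clockProfile :=
  ⟨clockProfile_convexOn, clockProfile_left, fun ν hν => by simpa [clockProfile] using D.admissible ν hν⟩

/-- THE CEILING NO-GO (witness form, PROVED): for ANY admissible ceiling data, ANY `ν₀ > 0` and ANY `η > 0` there is a
profile consistent with all of it whose certified supply `(g ν₀ + ν₀)/ν₀` (`= ∫₀^{ν₀} m′ / ν₀ ≥` nothing) is `< η` —
namely the clock profile, with supply `0`.  Hence {mean values + Jensen/Littlewood + functional equation + convexity}
certify `m′(ν₀) ≥ η > 0` for no `ν₀`: a FLOOR right of the line is necessary (card K-L21-5 (2), barrier W-ζ′-CEIL). -/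
theorem ceilingOnly_noGo (D : CeilingData) {ν₀ η : ℝ} (hν₀ : 0 < ν₀) (hη : 0 < η) :
    ∃ g : ℝ → ℝ, Consistent D g ∧ (g ν₀ + ν₀) / ν₀ < η :=
  ⟨clockProfile, clock_consistent D, by have : (0:ℝ) < ν₀ := hν₀; simp [clockProfile, hη]⟩

/-- FLOORS ACT TO THE RIGHT (PROVED, Mathlib convexity): for a convex profile with `g 0 = 0`, a floor value at
`ν_f ≤ ν₀` bounds every secant slope right of `ν₀` from below by `g ν_f / ν_f`; with `𝒢′ = m′ − 1` this is
`m′(ν₀) ≥ (𝒢(ν_f) + ν_f)/ν_f`, the convexity half of `ProfileSupplyLaw`.  (A floor at `ν_F > ν₀` gives at `ν₀` only the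
tangent extrapolation `−ν₀ + [∫₀^{ν_F} m′ − (ν_F − ν₀) m′(ν_F)]`, void once `ν_F ≳ (5/3) ν₀` for a `ν^{3/2}` onset.) -/
theorem floor_propagates_right {g : ℝ → ℝ} (hg : ConvexOn ℝ (Set.Ici 0) g) (h0 : g 0 = 0)
    {ν_f ν₀ ν₁ : ℝ} (hf : 0 < ν_f) (hf₀ : ν_f ≤ ν₀) (h₀₁ : ν₀ < ν₁) :
    g ν_f / ν_f ≤ (g ν₁ - g ν₀) / (ν₁ - ν₀) := by
  have hν₀ : 0 < ν₀ := hf.trans_le hf₀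
  have m0 : (0:ℝ) ∈ Set.Ici (0:ℝ) := Set.self_mem_Ici
  have mf : ν_f ∈ Set.Ici (0:ℝ) := hf.le
  have m₀ : ν₀ ∈ Set.Ici (0:ℝ) := hν₀.le
  have m₁ : ν₁ ∈ Set.Ici (0:ℝ) := (hν₀.trans h₀₁).le
  have step1 : (g ν_f - g 0) / (ν_f - 0) ≤ (g ν₀ - g 0) / (ν₀ - 0) :=
    hg.secant_mono m0 mf m₀ hf.ne' hν₀.ne' hf₀
  have step2 : (g ν₀ - g 0) / (ν₀ - 0) ≤ (g ν₁ - g ν₀) / (ν₁ - ν₀) :=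
    hg.slope_mono_adjacent m0 m₁ hν₀ h₀₁
  have e : g ν_f / ν_f = (g ν_f - g 0) / (ν_f - 0) := by simp [h0]
  rw [e]; exact step1.trans step2

end Summit.Parity.GeneralizedHardyLittlewood.Theorems.PrimeLevelFamEdgeIdeaDeltas.ZetaPrimeProfile
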